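import Literature.NumberTheory.EllipticCurves.NewformPeriodsGaloisEquivariance
import Literature.NumberTheory.EllipticCurves.NewformPeriodsGaloisEquivarianceProofs
import HarnessLib

/-!
# Discharge of the named fact `shimura1977_plusSymbol_galoisEquivariant` (Shimura 1977, Thm. 1, plus part)

Topic `NumberTheory/EllipticCurves`. The named fact `shimura1977_plusSymbol_galoisEquivariant` of
`NewformPeriodsGaloisEquivariance.lean` — `Aut(ℂ)`-equivariance of the normalised plus symbols `{∞,r}⁺_f/Ω⁺_f` of conjugate
newforms `f, f^σ ∈ S₂(Γ₀(N))` — is PROVED in the tree as `PeriodRank.plusSymbol_galoisEquivariant_of_conj`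
(`NewformPeriodsGaloisEquivarianceProofs.lean`: exactness of the Hecke span in an integral basis of the period homology,
`σ`-transport of the `K_f`-linear relations among rational cycles, Manin–Drinfeld cycles); this file records the one-line discharge
`_holds`. (The minus twin `shimura1977_minusSymbol_galoisEquivariant` is NOT discharged here.) [Shimura1977] Thm. 1.
-/

noncomputable section

namespace Literature.NumberTheory.EllipticCurves.ModularForms

/-- **Shimura 1977, Theorem 1 (plus part, weight 2, `Γ₀(N)`) HOLDS**: discharge of the named fact
`shimura1977_plusSymbol_galoisEquivariant` by the tree theorem `PeriodRank.plusSymbol_galoisEquivariant_of_conj`. [cite: Shimura1977, Thm. 1] -/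
theorem shimura1977_plusSymbol_galoisEquivariant_holds : shimura1977_plusSymbol_galoisEquivariant :=
  fun _ _ f f' hf hf' σ hconj ↦ PeriodRank.plusSymbol_galoisEquivariant_of_conj f f' hf hf' σ hconj

end Literature.NumberTheory.EllipticCurves.ModularForms

end
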